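import Literature.MathematicalPhysics.QuantumFieldTheory.Balaban1983to89.B6Hprime2101TorusAlgebra
import Literature.MathematicalPhysics.QuantumFieldTheory.Balaban1983to89.B5G183Kernel

/-!
# `Balaban1983to89.B6DeltaPrimeKernelTorus` — T. Bałaban, *Propagators and renormalization transformations for lattice gauge
# theories. II*, Commun. Math. Phys. **96** (1984) 223–250 [Balaban1984PropagatorsII], p.242 after (2.108): *«From this we
# get an exponential decay of Δ′_j(y − y′)»* — for the TYPED torus operator `Δ′_j = B6Hprime2101TorusAlgebra.dPOp`: its
# entries ARE the torus kernel of the strip-analytic multiplier (2.108), hence decay exponentially, uniformly in the fine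
# factor and the torus; `Δ′_j` is Hermitian

statement-level skeleton of published theorems with citation tags; proofs where landed; nothing here is a claim about the Yang–Mills mass gap

PDF held: `paper:balaban1984-cmp96-propagators-rt-ii` (journal page = PDF page + 222); p. 242 [PDF 20] read.

CITATION HEADER (lean-in-tree rule).  WHAT IS REPRODUCED: lit-balaban SKELETON rows **B6.Eq2.108** / **B6.Eq2.110**
((2.107)–(2.110) p. 242), the sentence after (2.108), verbatim: *"In momentum representation on the unit lattice the operator
Δ′_j is represented as the multiplication operator by the function Δ′_j(p′) = … (2.108)  From this we get an exponential decay
of Δ′_j(y − y′) and the bound c₀‖Δ₀ω‖² ≤ ⟨ω, Δ′_jω⟩ ≤ c₁‖Δ₀ω‖² ≤ γ₁‖ω‖². (2.109)"*  STATE OF THE TREE: the multiplier (2.108)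
continued to a d-only complex strip and the exponential decay of its infinite-lattice and torus KERNELS are theorems of
`…B6Hprime2101` (`stripRegular_dP`, `latticeKernel_dP_decay`, `torusKernel_dP_decay`); the TYPED torus operator `Δ′_j`
= `…B6Hprime2101TorusAlgebra.dPOp` (r03 g6, p254233: `(dft)ᴴ·diag(Δ′_j(p′))·dft`) carries (2.107) `eq2107_typed`, (2.108)
`dft_dPOp`, (2.109) `…B6DeltaPrime2109Torus.ineq2109`, (2.110) `…B6DeltaPrime2110Torus.ineq2110`.  THIS FILE closes the
dictionary for the decay sentence: **`dPOp_apply`** (the entries of the typed `Δ′_j` as the torus momentum sum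
`|T|⁻¹Σ_{p′} e^{ip′(y−y′)}Δ′_j(p′)`), **`dPOp_toT_eq_torusKernel`** (at lattice representatives they ARE
`B4TorusKernel.MultiPeriod.torusKernel` of the descended multiplier — `B6Hprime2132Torus.momentumSum_toT_eq_torusKernel` BY
NAME), hence **`norm_dPOp_le`**: `|Δ′_j(ȳ, ȳ′)| ≤ M_Δ′(d+1)·periodConst(κ_N(d+1), d)·e^{−(κ_N(d+1)/(d+1))|y − y′|_{T,∞}}`
uniformly in the fine factor `n ≥ 1` and in the torus (`torusKernel_dP_decay` BY NAME; constants d-only, ours); and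
`dPOp_conjTranspose` (`Δ′_j` is Hermitian: its multiplier is real on real momenta, `B6Hprime2101.dP_ofReal`).
Unit `lit-balaban-r03` (B6 reader/owner, gen 6; own lineage `B6Hprime2101TorusAlgebra` → `B6DeltaPrime2109Torus` →
`B6DeltaPrime2110Torus`; this file sits beside them), PHASE 2 (G.2(b) knitting), HOME `run/shared/lean/pub/lit-balaban/`,
2026-08-21.  IMPORTS `…B6Hprime2101TorusAlgebra` (transitively `…B6Hprime2132Torus`, `…B6Hprime2101`,
`…B5Kernel166Decay`) and `…B5G183Kernel` (`cT_mul_cT`) BY NAME; no new definition, no new named fact (theorems only).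

## Honest scope

(i) TORUS MODEL (finite periodic unit lattice of dimension `d + 1 ≥ 1` for the decay statement), as in the whole lineage.
(ii) The decay is an ENTRY bound at lattice representatives with the torus sup-metric; constants `M_Δ′`, `periodConst`,
`κ_N` are the crude d-only constants of `…B6Hprime2101`/`…B4TorusKernel`, not the paper's.  (iii) Value = kernel certificate
of bookkeeping (typed operator ↔ analysed kernel) for a located sentence of [Balaban1984PropagatorsII]; NOT summit progress,
NOT continuum, NOT Clay.
-/

open scoped BigOperators Matrix ComplexConjugate Real
open Finset Complex

namespace Literature.MathematicalPhysics.QuantumFieldTheory.Balaban1983to89.B6DeltaPrimeKernelTorus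

open Literature.MathematicalPhysics.QuantumFieldTheory.Balaban1983to89.B4Strip (ofRealVec)
open Literature.MathematicalPhysics.QuantumFieldTheory.Balaban1983to89.B4TorusKernel (descendC periodConst)
open Literature.MathematicalPhysics.QuantumFieldTheory.Balaban1983to89.B4TorusKernel.MultiPeriod (torusKernel torusSupNorm)
open Literature.MathematicalPhysics.QuantumFieldTheory.Balaban1983to89.B5Prop11Plancherel (Tor chi dft sOf conj_chi
  chi_add_right)
open Literature.MathematicalPhysics.QuantumFieldTheory.Balaban1983to89.B5Block118 (cT dft_apply' conj_dft)
open Literature.MathematicalPhysics.QuantumFieldTheory.Balaban1983to89.B5G183Kernel (cT_mul_cT)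
open Literature.MathematicalPhysics.QuantumFieldTheory.Balaban1983to89.B5Hk163Strip (kappaN kappaN_pos)
open Literature.MathematicalPhysics.QuantumFieldTheory.Balaban1983to89.B5Kernel166Decay (toT_sub chi_neg_comm)
open Literature.MathematicalPhysics.QuantumFieldTheory.Balaban1983to89.B6LowerBound2153Torus (toT)
open Literature.MathematicalPhysics.QuantumFieldTheory.Balaban1983to89.B6Cov2156Torus (one_le_M)
open Literature.MathematicalPhysics.QuantumFieldTheory.Balaban1983to89.B6Hprime2101 (dP MdP dP_ofReal stripRegular_dP
  torusKernel_dP_decay)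
open Literature.MathematicalPhysics.QuantumFieldTheory.Balaban1983to89.B6Hprime2101TorusAlgebra (dPOp)
open Literature.MathematicalPhysics.QuantumFieldTheory.Balaban1983to89.B6Hprime2132Torus (momentumSum_toT_eq_torusKernel)

noncomputable section

variable {d : ℕ}

/-! ## §1. Entries of a Fourier multiplier on the torus; the entries of the typed `Δ′_j` -/

section Entries

variable (n : ℕ) [NeZero n] (M : Fin d → ℕ) [hM : ∀ μ, NeZero (M μ)]

/-- **ENTRIES OF A FOURIER MULTIPLIER**: `(F* diag(m) F)(x, y) = |T|⁻¹ Σ_q e^{iq·(x−y)} m(q)` — the kernel of the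
multiplication operator by `m` in momentum representation. [cite: Balaban1984PropagatorsII, (2.108) p.242 «In momentum representation on the unit lattice the operator Δ′_j is represented as the multiplication operator by the function Δ′_j(p′)»] [folklore] -/
theorem multiplier_apply (m : Tor M → ℂ) (x y : Tor M) :
    ((dft M)ᴴ * Matrix.diagonal m * dft M) x y
      = ((Fintype.card (Tor M) : ℂ))⁻¹ * ∑ q : Tor M, chi M q (x - y) * m q := by
  rw [Matrix.mul_apply, Finset.mul_sum]
  refine Finset.sum_congr rfl fun q _ => ?_
  rw [Matrix.mul_diagonal, Matrix.conjTranspose_apply, ← starRingEnd_apply, conj_dft, dft_apply', sub_eq_add_neg,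
    chi_add_right, ← chi_neg_comm, ← conj_chi, ← cT_mul_cT]
  ring

/-- **THE ENTRIES OF THE TYPED `Δ′_j`**: `Δ′_j(x, y) = |T|⁻¹ Σ_{p′} e^{ip′·(x−y)} Δ′_j(p′)` — the object the print calls
`Δ′_j(y − y′)`. [cite: Balaban1984PropagatorsII, (2.108) p.242 «an exponential decay of Δ′_j(y − y′)»] [folklore] -/
theorem dPOp_apply (x y : Tor M) :
    dPOp n M x y = ((Fintype.card (Tor M) : ℂ))⁻¹ * ∑ q : Tor M, chi M q (x - y) * dP n (ofRealVec (sOf M q)) := by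
  rw [dPOp, multiplier_apply]

/-- the typed `Δ′_j` depends on `(x, y)` through `x − y` only (translation invariance on the torus).
[cite: Balaban1984PropagatorsII, (2.108) p.242 «Δ′_j(y − y′)»] [folklore] -/
theorem dPOp_apply_add (x y z : Tor M) : dPOp n M (x + z) (y + z) = dPOp n M x y := by
  rw [dPOp_apply, dPOp_apply, add_sub_add_right_eq_sub]

/-- **`Δ′_j` IS HERMITIAN** (its multiplier (2.108) is real on real momenta, `B6Hprime2101.dP_ofReal`).
[cite: Balaban1984PropagatorsII, (2.107)–(2.108) p.242] [folklore] -/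
theorem dPOp_conjTranspose : (dPOp n M)ᴴ = dPOp n M := by
  have hv : star (fun q : Tor M => dP n (ofRealVec (sOf M q))) = fun q => dP n (ofRealVec (sOf M q)) := by
    funext q
    rw [Pi.star_apply, dP_ofReal, ← starRingEnd_apply, Complex.conj_ofReal]
  rw [dPOp, Matrix.conjTranspose_mul, Matrix.conjTranspose_mul, Matrix.conjTranspose_conjTranspose,
    Matrix.diagonal_conjTranspose, hv, ← Matrix.mul_assoc]

/-- entrywise form of the Hermitian symmetry: `Δ′_j(y, x) = conj Δ′_j(x, y)`. [cite: Balaban1984PropagatorsII, (2.107)–(2.108) p.242] [folklore] -/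
theorem dPOp_apply_swap (x y : Tor M) : dPOp n M y x = conj (dPOp n M x y) := by
  have h := congrFun (congrFun (dPOp_conjTranspose n M) y) x
  rw [Matrix.conjTranspose_apply, ← starRingEnd_apply] at h
  exact h.symm

end Entries

/-! ## §2. The entries of the typed `Δ′_j` are the torus kernel of (2.108); exponential decay (dimension `d + 1 ≥ 1`) -/

section Decay

variable (n : ℕ) [NeZero n] (M : Fin (d + 1) → ℕ) [hM : ∀ μ, NeZero (M μ)]

/-- **THE DICTIONARY**: at lattice representatives `x, y ∈ ℤ^{d+1}` the entry `Δ′_j(x̄, ȳ)` of the typed operator IS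
`B4TorusKernel.MultiPeriod.torusKernel (descendC Δ′_j) M (x − y)` (`= Σ_m latticeKernel Δ′_j (x − y + Mm)`, the periodised
`ℤ^{d+1}`-Fourier kernel of the strip-analytic multiplier (2.108)). [cite: Balaban1984PropagatorsII, (2.108) p.242 (torus reading ours, momenta (1.29) of paper I p.23)] [folklore] -/
theorem dPOp_toT_eq_torusKernel (x y : Fin (d + 1) → ℤ) :
    dPOp n M (toT M x) (toT M y)
      = torusKernel (descendC (fun p : Fin (d + 1) → ℂ => dP n p)
          (stripRegular_dP n (kappaN_pos _).le le_rfl) (kappaN_pos _).le) M (x - y) := by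
  rw [dPOp_apply, toT_sub]
  exact momentumSum_toT_eq_torusKernel M (stripRegular_dP n (kappaN_pos _).le le_rfl) (kappaN_pos _).le (x - y)

/-- **«AN EXPONENTIAL DECAY OF Δ′_j(y − y′)» FOR THE TYPED OPERATOR**, uniformly in the period vector `M` (all `M_i ≥ 1`)
and in the fine factor `n ≥ 1`: for lattice representatives `x, y ∈ ℤ^{d+1}`,
`|Δ′_j(x̄, ȳ)| ≤ M_Δ′(d+1) · periodConst(κ_N(d+1), d) · e^{−(κ_N(d+1)/(d+1))|x − y|_{T,∞}}` (`B6Hprime2101.torusKernel_dP_decay`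
BY NAME; constants d-only, ours). [cite: Balaban1984PropagatorsII, (2.108) p.242 «From this we get an exponential decay of Δ′_j(y − y′)»] -/
theorem norm_dPOp_le (x y : Fin (d + 1) → ℤ) :
    ‖dPOp n M (toT M x) (toT M y)‖
      ≤ MdP (d + 1) * periodConst (kappaN (d + 1)) d *
          Real.exp (-(kappaN (d + 1) / (d + 1) * torusSupNorm M (x - y))) := by
  rw [dPOp_toT_eq_torusKernel]
  exact torusKernel_dP_decay n (one_le_M M) (x - y)

/-- consequently every `Δ′_jω` is bounded pointwise by an exponentially weighted sum of `|ω|`: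
`|(Δ′_jω)(x̄)| ≤ M_Δ′·periodConst · Σ_y e^{−(κ_N/(d+1))|x − r(y)|_{T,∞}} |ω(y)|` for any family of lattice representatives
`r : T₁ → ℤ^{d+1}` (`toT ∘ r = id`) — «a bounded operator with an exponential decay».
[cite: Balaban1984PropagatorsII, (2.108) p.242 «an exponential decay of Δ′_j(y − y′)»] [folklore] -/
theorem norm_dPOp_mulVec_le (ω : Tor M → ℂ) (x : Fin (d + 1) → ℤ) (r : Tor M → (Fin (d + 1) → ℤ))
    (hr : ∀ y, toT M (r y) = y) :
    ‖(dPOp n M *ᵥ ω) (toT M x)‖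
      ≤ MdP (d + 1) * periodConst (kappaN (d + 1)) d *
          ∑ y : Tor M, Real.exp (-(kappaN (d + 1) / (d + 1) * torusSupNorm M (x - r y))) * ‖ω y‖ := by
  rw [Matrix.mulVec, dotProduct, Finset.mul_sum]
  refine (norm_sum_le _ _).trans (Finset.sum_le_sum fun y _ => ?_)
  rw [norm_mul]
  have h := norm_dPOp_le n M x (r y)
  rw [hr] at h
  have hK : 0 ≤ MdP (d + 1) * periodConst (kappaN (d + 1)) d := by
    have h0 := norm_dPOp_le n M x (r y)
    rw [hr] at h0
    have hpos : 0 < Real.exp (-(kappaN (d + 1) / (d + 1) * torusSupNorm M (x - r y))) := Real.exp_pos _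
    nlinarith [norm_nonneg (dPOp n M (toT M x) y)]
  calc ‖dPOp n M (toT M x) y‖ * ‖ω y‖
      ≤ (MdP (d + 1) * periodConst (kappaN (d + 1)) d *
          Real.exp (-(kappaN (d + 1) / (d + 1) * torusSupNorm M (x - r y)))) * ‖ω y‖ :=
        mul_le_mul_of_nonneg_right h (norm_nonneg _)
    _ = _ := by ring

end Decay

end

end Literature.MathematicalPhysics.QuantumFieldTheory.Balaban1983to89.B6DeltaPrimeKernelTorus
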